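import Summits.BirchSwinnertonDyer.Rank1Residual.X12.O11.RouteUPrimeMember
import Summits.BirchSwinnertonDyer.Rank1Residual.X12.O11.RouteUSevenFullBSD
import Summits.BirchSwinnertonDyer.BirchSwinnertonDyer.Theorems.RamifiedSevenEllipticUnitsIndexIffControl
import Literature.NumberTheory.EllipticCurves.Wuthrich2014.ShaBoundProofs
import Literature.NumberTheory.EllipticCurves.AnalyticRankOrderProofs
import Literature.NumberTheory.EllipticCurves.Rank1Residual.X11RankOneCertificates.Minimality
import HarnessLib

set_option linter.dupNamespace false
set_option autoImplicit false

/-!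
# Route `RamifiedSevenEllipticUnits` (rung K7r), crux `EllipticUnitIndexSeven` (stmt-19143), stub
# `stub_bsdpSevenOnClassCSeven` AT THE LAST OPEN CENSUS MEMBER of 𝒞₇: `305809c1 = 49a1^{(−79)}` —
# per-member `BSD(E,7)` and full-BSD ASSEMBLY modulo one CERTIFIED-DATUM and one DATA binder

Cell `bsd-cm`, seat `bsd-cm-k7r-c2` (gen 2). HONEST FRAMING: BSD is not proved by any of this; the
class statement `EllipticUnitIndexSeven` (⇔ `BSD(E,7)` on the INFINITE class 𝒞₇ modulo the other cruxes,
gen 0 p418077) is untouched. This file is a PER-MEMBER assembly, in the currency of the cell's Route U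
(`RouteU.forall_bsdp_of_classCSeven`, `RouteU.bsdp_seven_of_classCSeven`): it closes NO cell by itself —
the lane books under the referee's conditions — and it is labelled ASSEMBLY MODULO BINDERS, not theorem.

THE MEMBER. `305809c1 = [1, −1, 0, −13652, 758379]` is the global minimal model of `49a1^{(−79)}`
(`N = 7²·79²`, `Δ = −7³·79⁶`, `j = −3375`, `r_an = 1`, torsion `ℤ/2`, `c₇ = 2` (III), `c₇₉ = 4` (I₀*)).
It is the ONE member of the O11@7 census (`N < 5·10⁵`) outside Route U's unit case: `7 ∣ β₁(−79)` and the
Mordell–Weil generator has `7`-adic level `1` (ram j236953), so Kriz–Li Thm 1.20 gives neither the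
analytic input (U-A) nor, via Buhler–Gross, the descent input (U-D); the planner's relaxed π-descent bound
is `2` (UD-PI-DESCENT §3: `r₇(ψ₂) = 1`).

WHAT IS NEW (this seat, 2026-08-26): the descent input **(U-D) `RouteU.SelmerSevenBound W` =
`#Sel^{(7)}(W/ℚ) ∣ 7` is now a CERTIFIED DATUM** — an EXACT `7`-isogeny descent with the true local
conditions: for `φ : W → W' = W/W[𝔭]` (kernel character `χ_{−79}ω⁵`) and its dual (`χ_{−79}ω²`),
`dim_𝔽₇ Sel^φ(W/ℚ) = 0` and `dim_𝔽₇ Sel^φ̂(W'/ℚ) = 1`, hence `dim Sel^{(7)}(W/ℚ) ≤ 1`. Two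
code-independent engines agree on every intermediate dimension, for this member and for the calibration
members `D ∈ {−11, −23, −43, −67, −71}` (unit case: Selmer class RAMIFIED at 7) and the second level-1
member `D = −107` (`N > 5·10⁵`): ENGINE A (kit j250795) = Kummer theory in `F = ℚ(ζ₇, √−79)`
(Schaefer–Stoll: `H¹(ℚ, 𝔽₇(κ)) = (F^×/F^{×7})(ωκ⁻¹)`, `S`-units + `Cl(F)[7]`, local `7`-th-power tests
by `idealstar` at the primes above `79` and `7`, local index at `7` from `φ^*ω' = ω` on minimal models and
`c₇(W) = c₇(W') = 2`); ENGINE B (kit j250884) = class field theory in the cyclic SEXTIC fields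
`L_κ ⊂ ℚ(ζ₇, √−79)` (ray class groups `Cl_{𝔓¹²}(L_κ)/7`, Frobenius-identified `κ`-eigenspaces, splitting
conditions). All class groups `bnfcertify`d (GRH-free). The unramified `φ̂`-Selmer line is the Kummer
class of the level-1 generator (locally trivial at `7`), i.e. exactly the `ψ₂ = ω²χ_{−79}` class of
`Cl(ℚ(ζ₇⁺, √−79))[7]` found by the planner (P-ram-U1 mechanism); the `7`-ramified class in the
`χ_{−79}ω⁵`-eigenspace is killed because the `φ`-side local condition at `7` is ZERO
(`#W'(ℚ₇)/φ(W(ℚ₇)) = 1`). Evidence: compute-j250795.json / j250884 on item stmt-BirchSwinnertonDyer-19143,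
memo K7R-EU-GAP-v3.md §3 + DESCENT-79.md (HOME/bsd-cm STATUS 2026-08-26).

WHAT IS PROVED HERE (kernel): the model binder and the three instances of the explicit minimal model
(as in `RouteUModelsA`: `IsElliptic` by `Δ ≠ 0`, `IsGloballyMinimal` by Silverman's integer criterion,
`N ≠ 0`), membership `ClassCSeven` (`RouteU.classCSeven_of_twist_cm7_prime` at `q = 79 ≡ 3 (4)`,
`(−7/79) = 1`), and the two compositions:
* `bsdp_seven_c305809c1` — `BSD(305809c1, 7)` from GZK, `r_an = 1`, (U-D) and (U-A);
* `forall_bsdp_c305809c1` — Miller's `BSD(305809c1, p)` at EVERY prime `p` (the `p ≠ 7` clauses are the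
  𝒞₇ assembly's named facts: Burungale–Flach/Rubin rank 0, modularity, Li–Liu–Tian, Kobayashi,
  Li–Tian–Yan–Zhu);
* `ellipticUnitIndexAt_c305809c1_of_strictControlAt` — the crux `(R-EU)@7` AT THIS MEMBER from
  `(R-ctrl)@7` there (p409726 + Cassels' isogeny invariance): a second relative t3-type witness for item
  19143, the first one off the unit case.
DISPLAYED BINDERS, by class (D62 grammar): NAMED FACTS ×6 (`hBF hmod hLLT hKob hLTYZ hGZK`); ANALYTIC
`hr1 : r_an = 1`; **CERTIFIED-DATUM `hD : SelmerSevenBound W`** (two engines above); **DATA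
`hA : ShaAnSevenUnit W`** (`#Ш_an ∈ ℚ` a `7`-unit: the lane's `Ш_an ≈ 1.000…` to 80 digits, ram
j236953/j237153 — an exact Gross–Zagier Heegner-index certificate is OWED for CERTIFIED-DATUM status).
No `sorry`, no new axiom, no instance beyond the three model facts (registered as theorems, Route-U style).

References: [Miller2011LMS] Def. 1.1; [SilvermanAEC2009] VII.1 Rem. 1.1, X.4.2; [Cremona1997] Table 1;
Schaefer–Stoll, Trans. AMS 356 (2004) §3, Lemma 3.8 (local images; shape only); [BuhlerGross1985] Ch. II;
[KrizLi2019] Thm 1.20 (why this member is outside the unit case).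
-/

noncomputable section

open scoped Classical
open NumberField WeierstrassCurve
open Literature.NumberTheory.EllipticCurves Literature.NumberTheory.EllipticCurves.Rank1Residual
open Literature.NumberTheory.EllipticCurves.ModularForms
open Summit.BirchSwinnertonDyer.Rank1Residual.X12
open Summit.BirchSwinnertonDyer.Rank1Residual.X12.O11.RouteU

namespace Summit.BirchSwinnertonDyer.BirchSwinnertonDyer.Theorems.RamifiedSevenEllipticUnits

/-! ## The explicit global minimal model `305809c1 = [1, −1, 0, −13652, 758379]` of `49a1^{(−79)}` -/

/-- `305809c1 = [1, -1, 0, -13652, 758379]` is a model of `49a1^{(−79)}`: the change of variables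
`[u, r, s, t] = [1, -20, 1/2, 0]` carries the tree's twist model `cm7.quadraticTwist (−79) =
[0, 237/4, 0, −12482, 493039]` to it (PARI `ellminimalmodel`, kit j250903; re-checked here by
`norm_num`). [cite: Cremona1997, Table 1 (labels); SilvermanAEC2009, III.1] -/
theorem exists_variableChange_c305809c1 :
    ∃ C : VariableChange ℚ, C • (⟨1, -1, 0, -13652, 758379⟩ : WeierstrassCurve ℚ) =
      cm7.quadraticTwist ((-(79 : ℕ) : ℤ) : ℚ) := by
  refine ⟨(⟨1, -20, 1/2, 0⟩ : VariableChange ℚ)⁻¹, ?_⟩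
  rw [inv_smul_eq_iff]
  ext <;> norm_num [cm7, quadraticTwist, WeierstrassCurve.variableChange_a₁,
    WeierstrassCurve.variableChange_a₂, WeierstrassCurve.variableChange_a₃,
    WeierstrassCurve.variableChange_a₄, WeierstrassCurve.variableChange_a₆, WeierstrassCurve.b₂,
    WeierstrassCurve.b₄, WeierstrassCurve.b₆]

/-- `305809c1` is an elliptic curve (`Δ = −7³·79⁶ ≠ 0`). [cite: SilvermanAEC2009, III.1 Prop. 1.4] -/
@[instance] theorem isElliptic_c305809c1 :
    (⟨1, -1, 0, -13652, 758379⟩ : WeierstrassCurve ℚ).IsElliptic :=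
  ⟨by
    rw [isUnit_iff_ne_zero]
    norm_num [WeierstrassCurve.Δ, WeierstrassCurve.b₂, WeierstrassCurve.b₄, WeierstrassCurve.b₆,
      WeierstrassCurve.b₈]⟩

/-- `305809c1 = [1, -1, 0, -13652, 758379]` is a GLOBAL MINIMAL model (`Δ = -83378997243703 =
−7³·79⁶`: no prime `ℓ` has `ℓ¹² ∣ Δ`; Silverman's integer criterion).
[cite: SilvermanAEC2009, VII.1 Remark 1.1] -/
@[instance] theorem isGloballyMinimal_c305809c1 :
    (⟨1, -1, 0, -13652, 758379⟩ : WeierstrassCurve ℚ).IsGloballyMinimal := by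
  have h := Rank1Residual.X11RankOneCertificates.isGloballyMinimal_of_int_criterion
    1 (-1) 0 (-13652) 758379 fun q hq ⟨hΔ, _⟩ => by
      have hD : Rank1Residual.X11RankOneCertificates.discOf [1, -1, 0, -13652, 758379] =
          -83378997243703 := by
        decide +kernel
      rw [hD, dvd_neg] at hΔ
      have hle : (q : ℤ) ^ 12 ≤ 83378997243703 := Int.le_of_dvd (by norm_num) hΔ
      have hqP : q < 15 := by
        by_contra h
        push Not at h
        have : (15 : ℤ) ^ 12 ≤ (q : ℤ) ^ 12 := by gcongr; exact_mod_cast h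
        norm_num at this
        omega
      interval_cases q <;> (try norm_num at hq) <;> (try norm_num at hΔ)
  exact_mod_cast h

/-- `N(305809c1) ≠ 0`. [folklore] -/
@[instance] theorem neZero_conductorNorm_c305809c1 :
    NeZero ((⟨1, -1, 0, -13652, 758379⟩ : WeierstrassCurve ℚ).conductorNorm ℤ) :=
  ⟨((⟨1, -1, 0, -13652, 758379⟩ : WeierstrassCurve ℚ).conductorNorm_pos_holds).ne'⟩

/-- **`305809c1 ∈ 𝒞₇`** (given `r_an = 1`): CM by `ℚ(√−7)`, good ordinary at `2`, the only bad prime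
`≠ 7` is `79 ≡ 2 (mod 7)`, split — `RouteU.classCSeven_of_twist_cm7_prime` at `q = 79`.
[cite: Miller2011LMS, §1 and Def. 1.1] -/
theorem classCSeven_c305809c1
    (hr1 : (⟨1, -1, 0, -13652, 758379⟩ : WeierstrassCurve ℚ).analyticRank = 1) :
    ClassCSeven (⟨1, -1, 0, -13652, 758379⟩ : WeierstrassCurve ℚ) := by
  haveI : Fact (Nat.Prime 79) := ⟨by norm_num⟩
  -- `(−7/79) = 1`: `79 ≡ 2 (mod 7)` splits in `ℚ(√−7)` (Euler's criterion, decided)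
  have hsq : legendreSym 79 (-7) = 1 := by
    rw [legendreSym_eq_ite 79 (by norm_num)]
    decide +revert
  exact classCSeven_of_twist_cm7_prime (q := 79) (by norm_num) (by norm_num)
    hsq _ exists_variableChange_c305809c1 hr1

/-! ## `BSD(305809c1, 7)` and full BSD, modulo (U-D) [CERTIFIED-DATUM] and (U-A) [DATA] -/

/-- **`BSD(305809c1, 7)` — ASSEMBLY modulo binders.** GZK (`hGZK`) + `r_an = 1` + the CERTIFIED descent
datum `hD : #Sel^{(7)}(W/ℚ) ∣ 7` (exact `7`-isogeny descent, kit j250795 + j250884, two engines,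
`bnfcertify`d) + the analytic DATA `hA : #Ш_an` a `7`-unit ⇒ Miller's `BSD(E,7)`
(`RouteU.bsdp_seven_of_classCSeven` = `X12.bsdp_of_classX12_of_card_selmerGroup_dvd`). This is the
instance of the reshaped line's `stub_bsdpSevenOnClassCSeven` at the member outside the unit case.
[cite: Miller2011LMS, §1 and Def. 1.1] [cite: SilvermanAEC2009, Thm X.4.2(a)] -/
theorem bsdp_seven_c305809c1 (hGZK : rank_eq_analyticRank_of_analyticRank_le_one)
    (hr1 : (⟨1, -1, 0, -13652, 758379⟩ : WeierstrassCurve ℚ).analyticRank = 1)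
    (hD : SelmerSevenBound (⟨1, -1, 0, -13652, 758379⟩ : WeierstrassCurve ℚ))
    (hA : ShaAnSevenUnit (⟨1, -1, 0, -13652, 758379⟩ : WeierstrassCurve ℚ)) :
    BSDp (⟨1, -1, 0, -13652, 758379⟩ : WeierstrassCurve ℚ) 7 :=
  bsdp_seven_of_classCSeven _ hGZK (classCSeven_c305809c1 hr1) hD hA

/-- **FULL BSD for `305809c1` — ASSEMBLY modulo binders** (Miller's `BSD(E, p)` at EVERY prime `p`):
the 𝒞₇ assembly `RouteU.forall_bsdp_of_classCSeven` on the explicit minimal model. Displayed: the six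
named facts (Burungale–Flach 2024 / Rubin 1991 rank `0` `hBF`, modularity `hmod`, Li–Liu–Tian 2024
`hLLT`, Kobayashi 2013 `hKob`, Li–Tian–Yan–Zhu 2025 `hLTYZ`, GZK `hGZK`), `r_an = 1`, the CERTIFIED-DATUM
`hD` (two-engine exact `7`-isogeny descent) and the DATA `hA` (`#Ш_an` a `7`-unit). With this member all
five 𝒞₇ members of conductor `< 5·10⁵` (`D ∈ {−11, −23, −67, −71, −79}`) have a per-member full-BSD
assembly in the tree (the first four by Route U). [cite: Miller2011LMS, §1 and Def. 1.1] -/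
theorem forall_bsdp_c305809c1 (hBF : bsdTriple_of_hasCM_of_L_one_ne_zero)
    (hmod : hasEntireLFunction_rat) (hLLT : LiLiuTian2024.thm11_bsdp_of_cm_rank_one)
    (hKob : Kobayashi2013.cor14_bsdp_of_cm_rank_one)
    (hLTYZ : LiTianYanZhu2025.thm11_bsdp_of_cm_rank_one)
    (hGZK : rank_eq_analyticRank_of_analyticRank_le_one)
    (hr1 : (⟨1, -1, 0, -13652, 758379⟩ : WeierstrassCurve ℚ).analyticRank = 1)
    (hD : SelmerSevenBound (⟨1, -1, 0, -13652, 758379⟩ : WeierstrassCurve ℚ))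
    (hA : ShaAnSevenUnit (⟨1, -1, 0, -13652, 758379⟩ : WeierstrassCurve ℚ)) :
    ∀ p : ℕ, p.Prime → BSDp (⟨1, -1, 0, -13652, 758379⟩ : WeierstrassCurve ℚ) p :=
  forall_bsdp_of_classCSeven _ hBF hmod hLLT hKob hLTYZ hGZK (classCSeven_c305809c1 hr1) hD hA

/-! ## The crux `(R-EU)@7` at this member, RELATIVE to `(R-ctrl)@7` (a second BC5/t3-type witness
for item 19143, outside the unit case; cf. ram's `stub_ellipticUnitIndexSeven_D11`, p413532) -/

/-- **`(R-ctrl)@(305809c1, 7) ⟹ (R-EU)@(305809c1, 7)`, modulo the member's binders.** `BSD(V, 7)` holds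
on the whole `ℚ`-isogeny class of the member: at the member by `bsdp_seven_c305809c1`, and it transports
to every isogenous globally minimal `V` by Cassels' isogeny invariance (`hCassels`, the named fact
`bsdRHS_eq_of_isIsogenous`; `Wuthrich2014.bsdp_of_isIsogenous`, with `Ш` finite by GZK and
`L'(E,1) ≠ 0` by `leadingLCoeff_ne_zero_holds` under modularity `hmod`); then p409726's
`ellipticUnitIndexAt_of_strictControlAt_of_bsdp_isogenyClass`. So at this member crux #2 carries no
content beyond crux #4 — now also OFF the unit case. [cite: Miller2011LMS, Def. 1.1 (arXiv:1010.2431 p. 3)]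
[cite: MilneADT2006, Thm. I.7.3 and Remark I.7.4] -/
theorem ellipticUnitIndexAt_c305809c1_of_strictControlAt (hCassels : bsdRHS_eq_of_isIsogenous)
    (hmod : hasEntireLFunction_rat) (hGZK : rank_eq_analyticRank_of_analyticRank_le_one)
    (hr1 : (⟨1, -1, 0, -13652, 758379⟩ : WeierstrassCurve ℚ).analyticRank = 1)
    (hD : SelmerSevenBound (⟨1, -1, 0, -13652, 758379⟩ : WeierstrassCurve ℚ))
    (hA : ShaAnSevenUnit (⟨1, -1, 0, -13652, 758379⟩ : WeierstrassCurve ℚ))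
    (hctrl : O11.RamifiedCMStrictControlAt (⟨1, -1, 0, -13652, 758379⟩ : WeierstrassCurve ℚ) 7) :
    O11.RamifiedCMEllipticUnitIndexAt (⟨1, -1, 0, -13652, 758379⟩ : WeierstrassCurve ℚ) 7 := by
  have hB : BSDp (⟨1, -1, 0, -13652, 758379⟩ : WeierstrassCurve ℚ) 7 :=
    bsdp_seven_c305809c1 hGZK hr1 hD hA
  have hfin : Finite (⟨1, -1, 0, -13652, 758379⟩ : WeierstrassCurve ℚ).sha :=
    (hGZK _ (by rw [hr1])).2
  have hlead : (⟨1, -1, 0, -13652, 758379⟩ : WeierstrassCurve ℚ).leadingLCoeff ≠ 0 :=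
    WeierstrassCurve.leadingLCoeff_ne_zero_holds (hmod _)
  exact ellipticUnitIndexAt_of_strictControlAt_of_bsdp_isogenyClass hctrl
    fun V _ _ hiso => Wuthrich2014.bsdp_of_isIsogenous hCassels hiso.symm_of_charZero hfin hlead hB

end Summit.BirchSwinnertonDyer.BirchSwinnertonDyer.Theorems.RamifiedSevenEllipticUnits

end
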